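import Summits.MatrixMultiplication.OmegaCensus.STPPVosperSlackTwoCheckersG

/-!
# ω-census (abelian STPP census): kernel CHECKER for the structure-free cell (2,2) of the slack-4 law (fifth ℤ₆₁ leaf)

HONEST FRAMING (pub-omega census; verbatim): lottery ticket; floor = certified bounds/negative ranges.
Census STRUCTURE (seat pub-omega-stpp-2 gen 28, 2026-08-29), family (b2).  The slack-4 partition law for the fifth ℤ₆₁ leaf `{(2,2,2),(3,3,3)²}`
(`STPPVosperSlackFourLawT.lean`, stpp-1 g33) leaves the cell `(#SY, #T) = (a+L+1, b+z+1) = (17, 17)` as the hypothesis `h22`: an EXACT PARTITION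
`ℤ/61 = W ⊔ SY ⊔ T`, `|W| = 27`, with BOTH pairs `(−Aᵢ, Y°)` and `(−Bᵢ, Z°)` two above Cauchy–Davenport.  By the (3,13)@61 two-above zoo
(`STPPZoo313Theorem.lean`) and the class maps of its 14 keys onto `{2, 3, 4}`, such a family has the NORMAL FORM (dilation, block-`i` translation,
global `B`- and `C`-shifts spent): `Aᵢ = −{0,1,y₀}`, the mask of `SY = −Aᵢ + Y°` is EXACTLY a shape `S ∈ c22Sh y₀` (`STPPVosperSlackFourCell22Shapes.lean`),
`Bᵢ = −u·{0,1,y₀′}` for a unit `u`, and the mask of `T = −Bᵢ + Z°` is `rot (u·S′) s` for a shape `S′ ∈ c22Sh y₀′` and some `s`.  This file is the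
kernel test that no such normal form exists, in the cheap order found by the python pilots (HOME `pub-omega-stpp-2-g28/code/c22lean.py`, an exact twin
of these definitions; stpp-1 g33's `cell22b.py` is the first, code-disjoint reading — both: 3 880 694 shape tests, 647 276 disjoint placements, 40 exactly
tiled, 696 realisations, 0 alive):
* placement: `T ∩ SY = ∅`.  With the PREFIX UNIONS `M(m) = ⋃_{j<m} (S − u·j)` (`c22Prefix`, once per `(u, S)`) and the runs `(t_k, m_k)` of `S′`, the
  forbidden shifts are `⋃_k (M(m_k) − u·t_k)` (`c22Forb`: 2–3 mask operations per shape instead of 17);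
* tiling (`c22Leaf`): `W = univ ∖ (SY ∪ T)` must be the union of the three translates `c − (Aᵢ + Bᵢ)`, `c ∈ Cᵢ`: at least 3 candidates `c` with
  `c − D ⊆ W` (`D` = the pattern `Aᵢ + Bᵢ`), and some 3 of them tile `W` exactly;
* realisation (`c22Leaf`): `Y°` is a 13-subset of `⋂_{x∈Aᵢ}(SY + x)` with `−Aᵢ + Y° = SY`, `Z°` likewise; every such value pair `(Yo, Zo)` must be in the
  dead table (`tbl22`, `STPPVosperSlackFourCell22TableP*.lean`, each entry `CoverDead` by a words-cover row).
Also: cyclic runs (`runsOf`, `runLen`, `dilRunsMask`), rotation normal form (`normRot`, `normMask`), affine images (`affMask`), sumset masks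
(`sumMask`), the class map `c22Cls`.  Control flow: `c22Place_of_c22CheckS`, `c22Leaf_of_c22Place`.  Soundness is a separate file.
Nothing here is progress on `ω`.

References: H. Cohn, R. Kleinberg, B. Szegedy, C. Umans, FOCS 2005 (arXiv:math/0511460), Def. 5.1.
-/

namespace Summit.MatrixMultiplication.OmegaCensus.CubeNB.S2

open Summit.MatrixMultiplication.OmegaCensus.CubeNB.Bits

/-! ## §1 Mask tools: cyclic runs, normal form under rotation, affine images, sumsets -/

/-- Length of the cyclic run of set bits of `m` starting at `v` (at most `p`). [folklore] -/
def runLen (p m v : ℕ) : ℕ := ((List.range p).takeWhile fun j => tb m ((v + j) % p)).length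

/-- The cyclic runs of `m` as `(start, length)` pairs: a run starts at `v` iff bit `v` is set and bit `v − 1 (mod p)` is clear. [folklore] -/
def runsOf (p m : ℕ) : List (ℕ × ℕ) :=
  ((List.range p).filter fun v => tb m v && !(tb m ((v + (p - 1)) % p))).map fun v => (v, runLen p m v)

/-- Mask of the `u`-dilate of a run list: `{u·(t + j) : (t, m) ∈ runs, j < m}`. [folklore] -/
def dilRunsMask (p u : ℕ) (runs : List (ℕ × ℕ)) : ℕ := maskOf (runs.flatMap fun r => (List.range r.2).map fun j => (u * (r.1 + j)) % p)

/-- Index of the (first) rotation minimising the mask. [folklore] -/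
def normRot (p m : ℕ) : ℕ := (List.range p).foldl (fun b t => if rot p m t < rot p m b then t else b) 0

/-- Rotation normal form of a mask (the minimal rotate). [folklore] -/
def normMask (p m : ℕ) : ℕ := rot p m (normRot p m)

/-- Mask of the affine image `v ↦ μ·v + c` of the members of `M`. [folklore] -/
def affMask (p μ c M : ℕ) : ℕ := maskOf ((members (List.range p) M).map fun v => (μ * v + c) % p)

/-- Mask of the sumset `X + M` (`X` a value list, `M` a mask): `⋃_{x ∈ X} (M + x)`. [folklore] -/
def sumMask (p : ℕ) (X : List ℕ) (M : ℕ) : ℕ := X.foldl (fun a x => a ||| rot p M x) 0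

/-- The class map of the 14 zoo keys `y` (`{0,1,y}` two above with a 13-set in `ℤ/61`) onto the representatives `y₀ ∈ {2,3,4}`: `(y₀, μ, c)` with
`μ·{0,1,y} + c = {0,1,y₀}`; `(0,0,0)` off the keys. [folklore] -/
def c22Cls (y : ℕ) : ℕ × ℕ × ℕ :=
  if y = 2 then (2, 1, 0) else if y = 31 then (2, 2, 0) else
  if y = 3 then (3, 1, 0) else if y = 21 then (3, 58, 3) else if y = 30 then (3, 2, 1) else if y = 32 then (3, 59, 3) else
  if y = 41 then (3, 3, 0) else if y = 59 then (3, 60, 1) else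
  if y = 4 then (4, 1, 0) else if y = 16 then (4, 57, 4) else if y = 20 then (4, 3, 1) else if y = 42 then (4, 58, 4) else
  if y = 46 then (4, 4, 0) else if y = 58 then (4, 60, 1) else (0, 0, 0)

/-! ## §2 The cell-(2,2) checker -/

/-- Value list of `Aᵢ = −{0, 1, y}` in `ℤ/p`. [folklore] -/
def c22P (p y : ℕ) : List ℕ := [0, p - 1, p - y]

/-- Value list of `Bᵢ = −u·{0, 1, y}` in `ℤ/p`. [folklore] -/
def c22Q (p u y : ℕ) : List ℕ := [0, (p - u % p) % p, (p - (u * y) % p) % p]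

/-- PREFIX UNIONS: entry `m` (`0 ≤ m ≤ 17`) is the mask `⋃_{j<m} (S − u·j)`. [folklore] -/
def c22Prefix (p u S : ℕ) : List ℕ := (List.range 18).map fun m => (List.range m).foldl (fun a j => a ||| rot p S ((p - (u * j) % p) % p)) 0

/-- FORBIDDEN SHIFTS of a `T`-shape with runs `(t_k, m_k)`: `⋃_k (M(m_k) − u·t_k)`; `s` is forbidden iff `u·S′ + s` meets `S`. [folklore] -/
def c22Forb (p u : ℕ) (Ms : List ℕ) (runs : List (ℕ × ℕ)) : ℕ :=
  runs.foldl (fun f r => f ||| rot p (Ms.getD r.2 0) ((p - (u * r.1) % p) % p)) 0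

/-- **LEAF at a placement** `(SY, T) = (S, T)` (masks): `W = univ ∖ (S ∪ T)`; candidates `c` with `c − D ⊆ W`; at least 3 and some 3 tile `W` exactly;
then every 13-sublist `Yo` of `⋂_{x∈P}(S + x)` with `−P + Yo = S` and every 13-sublist `Zo` of `⋂_{q∈Q}(T + q)` with `−Q + Zo = T` must form a table
entry `(Yo, Zo)`. [cite: CohnKleinbergSzegedyUmans2005, Def. 5.1] -/
def c22Leaf (p : ℕ) (P Q D : List ℕ) (negD S T : ℕ) (tbl : List (List ℕ × List ℕ)) : Bool :=
  let W := fullMask p ^^^ (S ||| T)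
  let cc := D.foldl (fun m d => m &&& rot p W d) (fullMask p)
  Nat.beq cc 0 ||
    (let cs := members (List.range p) cc
     !(Nat.ble 3 cs.length) ||
      (!((cs.sublistsLen 3).any fun c3 => Nat.beq (c3.foldl (fun m c => m ||| rot p negD c) 0) W) ||
        (((members (List.range p) (P.foldl (fun m x => m &&& rot p S x) (fullMask p))).sublistsLen 13).all fun Yo =>
          !(Nat.beq (P.foldl (fun m x => m ||| rot p (maskOf Yo) (p - x)) 0) S) ||
            ((members (List.range p) (Q.foldl (fun m q => m &&& rot p T q) (fullMask p))).sublistsLen 13).all fun Zo =>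
              !(Nat.beq (Q.foldl (fun m q => m ||| rot p (maskOf Zo) (p - q)) 0) T) || decide ((Yo, Zo) ∈ tbl))))

/-- **PLACEMENTS of one `T`-shape** `e = (u·S′ as a mask, runs of S′)`: every shift `s` outside the forbidden mask passes the leaf with `T = u·S′ + s`.
[cite: CohnKleinbergSzegedyUmans2005, Def. 5.1] -/
def c22Place (p u : ℕ) (P Q D : List ℕ) (negD S : ℕ) (Ms : List ℕ) (e : ℕ × List (ℕ × ℕ)) (tbl : List (List ℕ × List ℕ)) : Bool :=
  let allowed := fullMask p ^^^ c22Forb p u Ms e.2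
  Nat.beq allowed 0 || (members (List.range p) allowed).all fun s => c22Leaf p P Q D negD S (rot p e.1 s) tbl

/-- The `T`-shape data for a unit `u`: `(u·S′, runs of S′)` for each shape `S′`. [folklore] -/
def c22TShapes (p u : ℕ) (shapes : List ℕ) : List (ℕ × List (ℕ × ℕ)) := shapes.map fun S' => (dilRunsMask p u (runsOf p S'), runsOf p S')

/-- **THE CELL-(2,2) CHECK for one `(u, Aᵢ, Bᵢ, S)`**: value lists `P` of `Aᵢ` and `Q` of `Bᵢ`, pattern `D = P + Q` (must be duplicate-free, else
vacuous), `SY`-mask `S`, all `T`-shapes `tsh` and their placements. [cite: CohnKleinbergSzegedyUmans2005, Def. 5.1] -/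
def c22CheckS (p u : ℕ) (P Q : List ℕ) (S : ℕ) (tsh : List (ℕ × List (ℕ × ℕ))) (tbl : List (List ℕ × List ℕ)) : Bool :=
  let D := pattPQ p P Q
  !(decide D.Nodup) ||
    (let negD := maskOf (D.map fun d => (p - d) % p)
     let Ms := c22Prefix p u S
     tsh.all fun e => c22Place p u P Q D negD S Ms e tbl)

/-! ## §3 Control flow -/

/-- **`c22CheckS` is exhaustive over the shapes**: on a duplicate-free pattern every listed `T`-shape passes `c22Place`.
[cite: CohnKleinbergSzegedyUmans2005, Def. 5.1] -/
theorem c22Place_of_c22CheckS {p u : ℕ} {P Q : List ℕ} {S : ℕ} {tsh : List (ℕ × List (ℕ × ℕ))} {tbl : List (List ℕ × List ℕ)}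
    (h : c22CheckS p u P Q S tsh tbl = true) (hD : (pattPQ p P Q).Nodup) {e : ℕ × List (ℕ × ℕ)} (he : e ∈ tsh) :
    c22Place p u P Q (pattPQ p P Q) (maskOf ((pattPQ p P Q).map fun d => (p - d) % p)) S (c22Prefix p u S) e tbl = true := by
  unfold c22CheckS at h
  simp only [hD, decide_true, Bool.not_true, Bool.false_or, List.all_eq_true] at h
  exact h e he

/-- **`c22Place` is exhaustive over the shifts**: a shift `s < p` whose bit is clear in the forbidden mask passes the leaf.
[cite: CohnKleinbergSzegedyUmans2005, Def. 5.1] -/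
theorem c22Leaf_of_c22Place {p u : ℕ} {P Q D : List ℕ} {negD S : ℕ} {Ms : List ℕ} {e : ℕ × List (ℕ × ℕ)} {tbl : List (List ℕ × List ℕ)}
    (h : c22Place p u P Q D negD S Ms e tbl = true) {s : ℕ} (hs : s < p) (hfree : tb (c22Forb p u Ms e.2) s = false) :
    c22Leaf p P Q D negD S (rot p e.1 s) tbl = true := by
  unfold c22Place at h
  have hmem : s ∈ members (List.range p) (fullMask p ^^^ c22Forb p u Ms e.2) := by
    rw [mem_members, List.mem_range, tb_compl hs, hfree]; exact ⟨hs, rfl⟩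
  simp only [Bool.or_eq_true, List.all_eq_true] at h
  rcases h with h0 | hall
  · exfalso
    have hz := Nat.eq_of_beq_eq_true h0
    rw [hz] at hmem
    rw [mem_members, tb_eq_testBit, Nat.zero_testBit] at hmem
    exact Bool.noConfusion hmem.2
  · exact hall s hmem

/-! ## §4 Spot checks against the python twin (`code/c22lean.py`) -/

#guard runsOf 61 ((1 <<< 17) - 1) == [(0, 17)]
#guard runsOf 61 (((1 <<< 5) - 1) ||| (((1 <<< 12) - 1) <<< 40)) == [(0, 5), (40, 12)]
#guard runsOf 61 (1 ||| (1 <<< 60) ||| (((1 <<< 15) - 1) <<< 20)) == [(20, 15), (60, 2)]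
#guard dilRunsMask 61 1 [(20, 15), (60, 2)] == (1 ||| (1 <<< 60) ||| (((1 <<< 15) - 1) <<< 20))
#guard normMask 61 (((1 <<< 5) - 1) <<< 33) == (1 <<< 5) - 1
#guard affMask 61 2 0 (maskOf [0, 1, 31]) == maskOf [0, 1, 2]
#guard (List.range 61).all fun y => let c := c22Cls y; c.1 == 0 || affMask 61 c.2.1 c.2.2 (maskOf [0, 1, y]) == maskOf [0, 1, c.1]
#guard c22P 61 3 == [0, 60, 58] && c22Q 61 5 3 == [0, 56, 46]

end Summit.MatrixMultiplication.OmegaCensus.CubeNB.S2
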